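import Summits.Ventures.PercRepro0.Critical

/-!
# CRIT-LOWER with the exact edge-boundary count (seat p5, gen 34; permitted by lead RULING AE, STATUS l.2425)

`Sharp.crit_lower` (Critical.lean, p418282) bounds the boundary-pair count of `Λ_n` by
`|∂Λ_n| · d ≤ 2d (2n+1)^{d−1} · d`.  Counting the pairs `(x, y)`, `x ∈ Λ_n`, `y ∉ Λ_n`, `x ∼ y`
through the unit steps `(i, b)` instead — a step from `x ∈ Λ_n` leaves `Λ_n` iff `x_i = ±n` with the
matching sign, so each of the `2d` directions contributes at most one slice `{x ∈ Λ_n : x_i = ±n}` of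
`≤ (2n+1)^{d−1}` points — gives `Σ_{x ∈ Λ_n} |outNbrs x| ≤ 2d (2n+1)^{d−1}` for EVERY `n` (no `1 ≤ n`),
hence `P_{p_c(d)}(0 ↔ ∂Λ_n) ≥ 1 / (2d (2n+1)^{d−1})`: the constant `2d²` of CRITLOWER-p4-v2 improved
to `2d`, uniformly in `n ≥ 0`, from the same inputs (Lemma SAT = `one_le_phi_pc`, `P_connIn_box_le`,
`card_slice_le`).  Census evidence only (the CRIT-LOWER context row of block M); not an input to any declared
theorem; nothing claimed on `T(d)` for any `d`.
-/

namespace Summit.Ventures.PercRepro0.Sharp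

open MeasureTheory ProbabilityTheory unitInterval Set Filter
open Summit.Ventures.PercRepro0.Defs
open scoped ENNReal Classical Topology

variable {d : ℕ}

/-- A unit step from `x ∈ Λ_n` that leaves `Λ_n` has `x_i = n` (`b = true`) or `x_i = −n` (`b = false`). -/
theorem coord_eq_of_step_notMem_box {n : ℕ} {x : Vertex d} (hx : x ∈ box d n) {i : Fin d} {b : Bool}
    (hy : L2.step x i b ∉ box d n) : x i = (if b then (n : ℤ) else -(n : ℤ)) := by
  have hxi : -(n : ℤ) ≤ x i ∧ x i ≤ n := abs_le.1 (hx i)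
  have hstep_j : ∀ j, j ≠ i → L2.step x i b j = x j := fun j hj => by
    simp [L2.step, Function.update_of_ne hj]
  have hout : (n : ℤ) < |L2.step x i b i| := by
    by_contra hcon
    apply hy
    intro j
    by_cases hj : j = i
    · subst hj; exact not_lt.1 hcon
    · rw [hstep_j j hj]; exact hx j
  cases b with
  | true =>
    have hsi : L2.step x i true i = x i + 1 := by simp [L2.step]
    rw [hsi] at hout
    simp only [if_true]
    rcases lt_abs.1 hout with h | h <;> omega
  | false =>
    have hsi : L2.step x i false i = x i - 1 := by simp [L2.step]; ring
    rw [hsi] at hout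
    simp only [Bool.false_eq_true, if_false]
    rcases lt_abs.1 hout with h | h <;> omega

/-- The number of boundary pairs `(x, y)` with `x ∈ Λ_n`, `y ∉ Λ_n`, `x ∼ y` is at most `2d (2n+1)^{d−1}`,
for every `n` (the exact count is `2d (2n+1)^{d−1}`). -/
theorem sum_card_outNbrs_box_le (n : ℕ) :
    ∑ x ∈ boxF d n, (outNbrs (box d n) x).card ≤ 2 * d * (2 * n + 1) ^ (d - 1) := by
  have h1 : ∀ x ∈ boxF d n, (outNbrs (box d n) x).card ≤
      ((Finset.univ : Finset (Fin d × Bool)).filter fun ib => L2.step x ib.1 ib.2 ∉ box d n).card := by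
    intro x _
    have hsub : outNbrs (box d n) x ⊆
        ((Finset.univ : Finset (Fin d × Bool)).filter fun ib => L2.step x ib.1 ib.2 ∉ box d n).image
          (fun ib => L2.step x ib.1 ib.2) := by
      intro y hy
      obtain ⟨hadj, hyB⟩ := mem_outNbrs.1 hy
      obtain ⟨i, b, rfl⟩ := L2.exists_step_of_adj hadj
      exact Finset.mem_image.2 ⟨(i, b), Finset.mem_filter.2 ⟨Finset.mem_univ _, hyB⟩, rfl⟩
    exact (Finset.card_le_card hsub).trans Finset.card_image_le
  calc ∑ x ∈ boxF d n, (outNbrs (box d n) x).card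
      ≤ ∑ x ∈ boxF d n,
          ((Finset.univ : Finset (Fin d × Bool)).filter fun ib => L2.step x ib.1 ib.2 ∉ box d n).card :=
        Finset.sum_le_sum h1
    _ = ∑ x ∈ boxF d n, ∑ ib : Fin d × Bool, (if L2.step x ib.1 ib.2 ∉ box d n then 1 else 0) := by
        simp only [Finset.card_filter]
    _ = ∑ ib : Fin d × Bool, ∑ x ∈ boxF d n, (if L2.step x ib.1 ib.2 ∉ box d n then 1 else 0) :=
        Finset.sum_comm
    _ = ∑ ib : Fin d × Bool, ((boxF d n).filter fun x => L2.step x ib.1 ib.2 ∉ box d n).card := by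
        simp only [Finset.card_filter]
    _ ≤ ∑ _ib : Fin d × Bool, (2 * n + 1) ^ (d - 1) := by
        refine Finset.sum_le_sum fun ib _ => ?_
        refine (Finset.card_le_card ?_).trans (card_slice_le n ib.1 (if ib.2 then (n : ℤ) else -(n : ℤ)))
        intro x hx
        rw [Finset.mem_filter] at hx ⊢
        exact ⟨hx.1, coord_eq_of_step_notMem_box (mem_boxF.1 hx.1) hx.2⟩
    _ = 2 * d * (2 * n + 1) ^ (d - 1) := by
        rw [Finset.sum_const, Finset.card_univ, Fintype.card_prod, Fintype.card_fin, Fintype.card_bool,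
          smul_eq_mul]
        ring

/-- **CRIT-LOWER, sharper constant**: for every `d ≥ 1` and every `n ≥ 0`,
`P_{p_c(d)}(0 ↔ ∂Λ_n) ≥ 1 / (2d (2n+1)^{d−1})` (no case split at `n = 0`). -/
theorem crit_lower' (hd : 1 ≤ d) (n : ℕ) :
    1 / (2 * (d : ℝ) * (2 * (n : ℝ) + 1) ^ (d - 1)) ≤ (P d (clamp (pc d)) (toBoundary d n)).toReal := by
  have hd' : (1 : ℝ) ≤ d := by exact_mod_cast hd
  have hden : 0 < 2 * (d : ℝ) * (2 * (n : ℝ) + 1) ^ (d - 1) := by positivity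
  set p : I := clamp (pc d) with hp
  have hp1 : (p : ℝ) ≤ 1 := p.2.2
  set θ : ℝ := (P d p (toBoundary d n)).toReal with hθ
  have hθ0 : 0 ≤ θ := ENNReal.toReal_nonneg
  have hsat : 1 ≤ phi (boxF d n) p := one_le_phi_pc hd (mem_boxF.2 (zero_mem_box n))
  -- each term of `φ` is at most `|outNbrs x| · θ`
  have hterm : ∀ x ∈ boxF d n, ((outNbrs (↑(boxF d n)) x).card : ℝ) *
      (P d p {ω : Config d | ConnIn (↑(boxF d n)) ω 0 x}).toReal ≤
        ((outNbrs (box d n) x).card : ℝ) * θ := by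
    intro x hx
    rw [coe_boxF]
    have hxB : x ∈ box d n := mem_boxF.1 hx
    by_cases hne : outNbrs (box d n) x = ∅
    · rw [hne]; simp
    · obtain ⟨y, hy⟩ := Finset.nonempty_iff_ne_empty.2 hne
      obtain ⟨hadj, hyB⟩ := mem_outNbrs.1 hy
      obtain ⟨i, b, rfl⟩ := L2.exists_step_of_adj hadj
      have hxb : x ∈ boundary d n := by
        refine ⟨hxB, i, ?_⟩
        have hc := coord_eq_of_step_notMem_box hxB hyB
        cases b with
        | true => simp only [if_true] at hc; rw [hc]; simp
        | false => simp only [Bool.false_eq_true, if_false] at hc; rw [hc]; simp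
      exact mul_le_mul_of_nonneg_left (P_connIn_box_le p hxb) (Nat.cast_nonneg _)
  have hcount : (∑ x ∈ boxF d n, ((outNbrs (box d n) x).card : ℝ)) ≤
      2 * (d : ℝ) * (2 * (n : ℝ) + 1) ^ (d - 1) := by
    have := sum_card_outNbrs_box_le (d := d) n
    exact_mod_cast this
  have hsum : ∑ x ∈ boxF d n, ((outNbrs (↑(boxF d n)) x).card : ℝ) *
      (P d p {ω : Config d | ConnIn (↑(boxF d n)) ω 0 x}).toReal ≤
        (2 * (d : ℝ) * (2 * (n : ℝ) + 1) ^ (d - 1)) * θ := by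
    calc ∑ x ∈ boxF d n, ((outNbrs (↑(boxF d n)) x).card : ℝ) *
          (P d p {ω : Config d | ConnIn (↑(boxF d n)) ω 0 x}).toReal
        ≤ ∑ x ∈ boxF d n, ((outNbrs (box d n) x).card : ℝ) * θ := Finset.sum_le_sum hterm
      _ = (∑ x ∈ boxF d n, ((outNbrs (box d n) x).card : ℝ)) * θ := by rw [Finset.sum_mul]
      _ ≤ (2 * (d : ℝ) * (2 * (n : ℝ) + 1) ^ (d - 1)) * θ := mul_le_mul_of_nonneg_right hcount hθ0
  have hphi : phi (boxF d n) p ≤ 2 * (d : ℝ) * (2 * (n : ℝ) + 1) ^ (d - 1) * θ := by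
    unfold phi
    calc (p : ℝ) * ∑ x ∈ boxF d n, ((outNbrs (↑(boxF d n)) x).card : ℝ) *
          (P d p {ω : Config d | ConnIn (↑(boxF d n)) ω 0 x}).toReal
        ≤ 1 * ((2 * (d : ℝ) * (2 * (n : ℝ) + 1) ^ (d - 1)) * θ) :=
          mul_le_mul hp1 hsum (Finset.sum_nonneg fun x _ =>
            mul_nonneg (Nat.cast_nonneg _) ENNReal.toReal_nonneg) zero_le_one
      _ = 2 * (d : ℝ) * (2 * (n : ℝ) + 1) ^ (d - 1) * θ := by ring
  rw [div_le_iff₀ hden]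
  linarith

/-- The sharper bound implies the declared one (`2d ≤ 2d²` for `d ≥ 1`). -/
theorem crit_lower_of_crit_lower' (hd : 1 ≤ d) (n : ℕ) :
    1 / (2 * (d : ℝ) ^ 2 * (2 * (n : ℝ) + 1) ^ (d - 1)) ≤ (P d (clamp (pc d)) (toBoundary d n)).toReal := by
  refine le_trans ?_ (crit_lower' hd n)
  have hd' : (1 : ℝ) ≤ d := by exact_mod_cast hd
  have hpos : 0 < (2 * (n : ℝ) + 1) ^ (d - 1) := by positivity
  apply one_div_le_one_div_of_le
  · positivity
  · have : (d : ℝ) ≤ (d : ℝ) ^ 2 := by nlinarith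
    nlinarith [hpos]

end Summit.Ventures.PercRepro0.Sharp
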